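import Summits.BirchSwinnertonDyer.BirchSwinnertonDyer.Theorems.KatoDescentTamePotSupersingularTameLowerPdescShape
import Summits.BirchSwinnertonDyer.Rank1Residual.X11b.KrausMinimalityGeneralTwo
import HarnessLib

/-!
# Route `KatoDescentTamePotSupersingular` (rung K8-t′ = KT, cell `bsd-potss`), child crux `TameLowerIntrinsicNonCM`
# (item stmt-BirchSwinnertonDyer-19618), registered stub `stub_intr_residualNonCM` (REDUCIBLE disjunct) — RECORDS part 04
# (3 classes: `313600en`, `416025cb`, `498550l`): the per-class LOWER half `MissingLowerBoundAt W 5` on INTRINSIC (t′) rank-0 classes with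
# `E[5]` reducible, from four PUBLISHED facts + ONE two-engine `5`-isogeny-descent certificate line per class
# (seat `bsd-potss-kt-pdesc`, ACCEL row (4) of planner bsd-potss-plan g14; `--supports stmt-BirchSwinnertonDyer-19618 --as helper`;
# closes NOTHING class-wide)

PARTITION (D-0054, cell bsd-potss): EXCLUDED-DOMAIN non-CM additive `p` · B4 (t′) (`e ∈ {3,4,6}`; here `p = 5`, Kodaira `IV`/`II` (`e = 3`/`6`)),
`r_an = 0`, INTRINSIC classes (every member `5 ∣ #Ш_an`) × {`E[5]` reducible} — rows of the registered stub
`Sig.stub_intr_residualNonCM` of the birth skeleton v4 of 19618 (planner g15): on a reducible row `ρ̄` is not onto and the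
`3`-adic tower is not onto, so the row is off every Kurihara-certificate road of the skeleton. Per class; class-wide the stub
is Kato's Conj. 12.10 lower half at an additive potentially supersingular prime (OPEN). HONEST FRAMING: BSD is not proved by
any of this; nothing here is new mathematics; THEOREMS ONLY (no definition, no named fact, no `sorry`); nothing is booked here.

Each record instantiates `KTPdesc.missingLowerBoundAt_of_isIsogenous_ainvs_of_selmerGroup_ne_bot` (Selmer currency: classes
with no rational `5`-torsion anywhere in the class) or `KTPdesc.missingLowerBoundAt_of_isIsogenous_ainvs_of_shaWitness`
(Ш-witness currency: classes meeting rational `5`-torsion, where `5 ∣ #Ẽ(𝔽_ℓ)` at every good `ℓ` for every member) of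
`…TameLowerPdescShape.lean` on the literal Cremona model `W₀` of the certificate member; the conclusion holds at EVERY
globally minimal `W ∼_ℚ W₀` (binder `hiso` = the Cremona class datum). DECIDED IN THE KERNEL: `Δ ≠ 0`, global minimality
(`X11b.isGloballyMinimal_of_krausCriterion_support`: the support of `Δ` + Silverman / Kraus per prime) and, in the Selmer
currency, `5 ∤ #W₀(ℚ)_tors` from one odd good prime `ℓ` with `5 ∤ #Ẽ(𝔽_ℓ)` (`countPoints`). DISPLAYED binders: the
PUBLISHED named facts `hCT` (Cassels–Tate), `hCassels` (Cassels), `hGZK`, `hmod`; per class `hr` (`r_an = 0`, Cremona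
`allbsd`), `hs`/`hv` (`#Ш_an(W₀) = s`, `ord_5 s ≤ 2`; value quoted per docstring) and the certificate line `hSel :
Sel^(5)(W₀/ℚ) ≠ ⊥` resp. `hwit : ∃ x ∈ Ш(W₀), x ≠ 0, 5·x = 0`, whose EVIDENCE is quoted per record: the row of kit
**j257757** (this seat; engines 2χ `isogchi.gp` sha256 42175383… and 2cft `isogcft.gp` sha256 0e36e3a0… of cell
b2b-bsdres-sha-2, UNMODIFIED; two independent methods per kernel — Kummer side over the `S`-units of `L = ℚ(T)` vs.
class-field-theory side over the ray class group of `L` —, IDENTICAL `(ŝ, s_φ, m, excess)` on all 298 kernels run, both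
Poitou–Tate identities PASS, 112 null kernels with `ord_p #Ш_an = 0` on both sides all show excess `0`; `HOME/kt-pdesc/`).
Chain (PROVED in the tree below the named facts): `dim Ш(W₀)[φ] ≥ 1` ⇒ `Ш(W₀)[5] ≠ 0` (⇒ `Sel^(5)(W₀/ℚ) ≠ ⊥`) ⇒
`5 ∣ #Ш(W₀)` ⇒ `5² ∣ #Ш(W₀)` (Cassels–Tate) ⇒ `ord_5 #Ш_an(W₀) = 2 ≤ ord_5 #Ш(W₀)`; Cassels' isogeny invariance
carries the lower half to every member.

References: [SilvermanAEC2009] Thm. X.4.14, VII.1 Rem. 1.1, VII.3.1(b); [Kraus1989] Prop. 1–2; [MilneADT2006] Thm. I.7.3;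
[Miller2011LMS] Def. 1.1; [Cremona2006] Table 1; Schaefer, J. Number Theory 56 (1996) L. 3.8; [SchaeferStoll2004];
[Kato2004Asterisque] Conj. 12.10 (p. 224).
-/

set_option autoImplicit false
set_option linter.dupNamespace false

noncomputable section

open scoped Classical

open WeierstrassCurve Literature.NumberTheory.EllipticCurves
  Literature.NumberTheory.EllipticCurves.Rank1Residual
  Literature.NumberTheory.EllipticCurves.Rank1Residual.Typed
  Summit.BirchSwinnertonDyer.Rank1Residual

namespace Summit.BirchSwinnertonDyer.BirchSwinnertonDyer.Theorems

/-- **L₀ `MissingLowerBoundAt · 5` on the intrinsic (t′) class `313600en`** (`E[5]` reducible, image `B`; `N =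
313600 = 2^8·5^2·7^2`; Kodaira type `IV` at `5` (`e = 3`); members: 313600en1 `#Ш_an = 25`, `#tors = 1`, `∏c = 4`,
313600en2 `#Ш_an = 25`, `#tors = 1`, `∏c = 4`; no rational `5`-torsion in the class). Certificate member `W₀ =
313600en1 = [0, 1, 0, -9404733, -11104281637]` (Cremona `allbsd`: `r_an = 0`, `#Ш_an(W₀) = 25`, `ord_5 = 2`).
Kernel-decided: `Δ(W₀) ≠ 0`, global minimality (support of `Δ` = `[(2, 8, 15), (5, 2, 4), (7, 2, 8)]` as `(q, v_q N,
v_q Δ)`; Silverman/Kraus disjunct per prime: 2:b, 5:a, 7:a), `5 ∤ #W₀(ℚ)_tors` from `#Ẽ(𝔽_{3}) = 3`. Binders: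
PUBLISHED `hCT`, `hCassels`, `hGZK`, `hmod`; per class `hr`, `hs`/`hv`, `hSel : Sel^(5)(W₀/ℚ) ≠ ⊥` — EVIDENCE: kit
j257757 (this seat; 2χ `isogchi.gp` 42175383… / 2cft `isogcft.gp` 0e36e3a0…, unmodified, AGREE, duality PASS) row
`313600en1`: rational `5`-isogeny `φ` with kernel polynomial `x^2 + 3454*x + 2980569` (kernel field degree `d = 4`)
onto `313600en2` (`#tors = 1`, `#Ш_an = 25`), `(s_φ, ŝ, m, excess) = (1, 1, 0, 2)`, Mordell–Weil split at rank `0`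
`(q_φ, q_φ̂) = (0, 0)` ⇒ `dim Ш(W₀)[φ] = s_φ − q_φ = 1 ≥ 1` (and `dim Ш(313600en2)[φ̂] = 1`) ⇒ `Ш(W₀)[5] ≠ 0` ⇒
`Sel^(5)(W₀/ℚ) ≠ ⊥` (`W₀(ℚ)[5] = 0`); `hiso`: the Cremona class 313600en (2 curves). Per class; nothing booked.
[cite: SilvermanAEC2009, Thm. X.4.14 and VII.1 Remark 1.1] [cite: Miller2011LMS, §1 and Def. 1.1] [cite:
Cremona2006, Table 1 (Cremona label 313600en1)] -/
theorem KTPdesc.lower5_sel_313600en1 (hCT : exists_casselsTate_pairing (K := ℚ))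
    (hCassels : bsdRHS_eq_of_isIsogenous) (hGZK : rank_eq_analyticRank_of_analyticRank_le_one)
    (hmod : hasEntireLFunction_rat) (W₀ : WeierstrassCurve ℚ) (hW₀ : W₀ = ⟨0, 1, 0, -9404733, -11104281637⟩)
    (hr : W₀.analyticRank = 0) {s : ℚ} (hs : shaAn W₀ = (s : ℂ)) (hv : padicValRat 5 s ≤ 2)
    (hSel : W₀.selmerGroup (5 : ℤ) ≠ ⊥) (W : WeierstrassCurve ℚ) [W.IsElliptic] [W.IsGloballyMinimal]
    (hiso : IsIsogenous W W₀) : MissingLowerBoundAt W 5 := by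
  subst hW₀
  haveI : Fact (Nat.Prime 5) := ⟨by norm_num⟩
  exact KTPdesc.missingLowerBoundAt_of_isIsogenous_ainvs_of_selmerGroup_ne_bot hCT hCassels hGZK hmod
    0 1 0 (-9404733) (-11104281637)
    (X11b.isGloballyMinimal_of_krausCriterion_support 0 1 0 (-9404733) (-11104281637)
      [(2, 8, 15), (5, 2, 4), (7, 2, 8)]
      (by intro t ht; simp only [List.mem_cons, List.not_mem_nil, or_false] at ht; rcases ht with rfl | rfl | rfl <;> norm_num)
      (by decide +kernel) (by decide +kernel))
    5 3 (by norm_num) (by norm_num) (by decide +kernel) (n := 3) (by decide +kernel) (by decide)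
    hr hs hv hSel W hiso

/-- **L₀ `MissingLowerBoundAt · 5` on the intrinsic (t′) class `416025cb`** (`E[5]` reducible, image `B`; `N =
416025 = 3^2·5^2·43^2`; Kodaira type `IV` at `5` (`e = 3`); members: 416025cb1 `#Ш_an = 25`, `#tors = 1`, `∏c = 2`,
416025cb2 `#Ш_an = 25`, `#tors = 1`, `∏c = 2`; no rational `5`-torsion in the class). Certificate member `W₀ =
416025cb1 = [0, 0, 1, -138675, -20373669]` (Cremona `allbsd`: `r_an = 0`, `#Ш_an(W₀) = 25`, `ord_5 = 2`).
Kernel-decided: `Δ(W₀) ≠ 0`, global minimality (support of `Δ` = `[(3, 2, 7), (5, 2, 4), (43, 2, 6)]` as `(q, v_q N,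
v_q Δ)`; Silverman/Kraus disjunct per prime: 3:a, 5:a, 43:a), `5 ∤ #W₀(ℚ)_tors` from `#Ẽ(𝔽_{11}) = 14`. Binders:
PUBLISHED `hCT`, `hCassels`, `hGZK`, `hmod`; per class `hr`, `hs`/`hv`, `hSel : Sel^(5)(W₀/ℚ) ≠ ⊥` — EVIDENCE: kit
j257757 (this seat; 2χ `isogchi.gp` 42175383… / 2cft `isogcft.gp` 0e36e3a0…, unmodified, AGREE, duality PASS) row
`416025cb1`: rational `5`-isogeny `φ` with kernel polynomial `x^2 + 215*x - 9245` (kernel field degree `d = 4`) onto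
`416025cb2` (`#tors = 1`, `#Ш_an = 25`), `(s_φ, ŝ, m, excess) = (1, 1, 0, 2)`, Mordell–Weil split at rank `0` `(q_φ,
q_φ̂) = (0, 0)` ⇒ `dim Ш(W₀)[φ] = s_φ − q_φ = 1 ≥ 1` (and `dim Ш(416025cb2)[φ̂] = 1`) ⇒ `Ш(W₀)[5] ≠ 0` ⇒
`Sel^(5)(W₀/ℚ) ≠ ⊥` (`W₀(ℚ)[5] = 0`); `hiso`: the Cremona class 416025cb (2 curves). Per class; nothing booked.
[cite: SilvermanAEC2009, Thm. X.4.14 and VII.1 Remark 1.1] [cite: Miller2011LMS, §1 and Def. 1.1] [cite: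
Cremona2006, Table 1 (Cremona label 416025cb1)] -/
theorem KTPdesc.lower5_sel_416025cb1 (hCT : exists_casselsTate_pairing (K := ℚ))
    (hCassels : bsdRHS_eq_of_isIsogenous) (hGZK : rank_eq_analyticRank_of_analyticRank_le_one)
    (hmod : hasEntireLFunction_rat) (W₀ : WeierstrassCurve ℚ) (hW₀ : W₀ = ⟨0, 0, 1, -138675, -20373669⟩)
    (hr : W₀.analyticRank = 0) {s : ℚ} (hs : shaAn W₀ = (s : ℂ)) (hv : padicValRat 5 s ≤ 2)
    (hSel : W₀.selmerGroup (5 : ℤ) ≠ ⊥) (W : WeierstrassCurve ℚ) [W.IsElliptic] [W.IsGloballyMinimal]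
    (hiso : IsIsogenous W W₀) : MissingLowerBoundAt W 5 := by
  subst hW₀
  haveI : Fact (Nat.Prime 5) := ⟨by norm_num⟩
  exact KTPdesc.missingLowerBoundAt_of_isIsogenous_ainvs_of_selmerGroup_ne_bot hCT hCassels hGZK hmod
    0 0 1 (-138675) (-20373669)
    (X11b.isGloballyMinimal_of_krausCriterion_support 0 0 1 (-138675) (-20373669)
      [(3, 2, 7), (5, 2, 4), (43, 2, 6)]
      (by intro t ht; simp only [List.mem_cons, List.not_mem_nil, or_false] at ht; rcases ht with rfl | rfl | rfl <;> norm_num)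
      (by decide +kernel) (by decide +kernel))
    5 11 (by norm_num) (by norm_num) (by decide +kernel) (n := 14) (by decide +kernel) (by decide)
    hr hs hv hSel W hiso

/-- **L₀ `MissingLowerBoundAt · 5` on the intrinsic (t′) class `498550l`** (`E[5]` reducible, image `B`; `N = 498550
= 2·5^2·13^2·59`; Kodaira type `II` at `5` (`e = 6`); members: 498550l1 `#Ш_an = 25`, `#tors = 1`, `∏c = 4`,
498550l2 `#Ш_an = 25`, `#tors = 1`, `∏c = 20`; no rational `5`-torsion in the class). Certificate member `W₀ =
498550l1 = [1, 1, 0, -10609224785, 425913082259605]` (Cremona `allbsd`: `r_an = 0`, `#Ш_an(W₀) = 25`, `ord_5 = 2`).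
Kernel-decided: `Δ(W₀) ≠ 0`, global minimality (support of `Δ` = `[(2, 1, 25), (5, 2, 2), (13, 2, 16), (59, 1, 2)]`
as `(q, v_q N, v_q Δ)`; Silverman/Kraus disjunct per prime: 2:a, 5:a, 13:a, 59:a), `5 ∤ #W₀(ℚ)_tors` from `#Ẽ(𝔽_{7})
= 6`. Binders: PUBLISHED `hCT`, `hCassels`, `hGZK`, `hmod`; per class `hr`, `hs`/`hv`, `hSel : Sel^(5)(W₀/ℚ) ≠ ⊥` —
EVIDENCE: kit j257757 (this seat; 2χ `isogchi.gp` 42175383… / 2cft `isogcft.gp` 0e36e3a0…, unmodified, AGREE,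
duality PASS) row `498550l1`: rational `5`-isogeny `φ` with kernel polynomial `x^2 - 64100*x - 208460604` (kernel
field degree `d = 2`) onto `498550l2` (`#tors = 1`, `#Ш_an = 25`), `(s_φ, ŝ, m, excess) = (1, 1, 0, 2)`,
Mordell–Weil split at rank `0` `(q_φ, q_φ̂) = (0, 0)` ⇒ `dim Ш(W₀)[φ] = s_φ − q_φ = 1 ≥ 1` (and `dim Ш(498550l2)[φ̂]
= 1`) ⇒ `Ш(W₀)[5] ≠ 0` ⇒ `Sel^(5)(W₀/ℚ) ≠ ⊥` (`W₀(ℚ)[5] = 0`); `hiso`: the Cremona class 498550l (2 curves). Per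
class; nothing booked. [cite: SilvermanAEC2009, Thm. X.4.14 and VII.1 Remark 1.1] [cite: Miller2011LMS, §1 and Def.
1.1] [cite: Cremona2006, Table 1 (Cremona label 498550l1)] -/
theorem KTPdesc.lower5_sel_498550l1 (hCT : exists_casselsTate_pairing (K := ℚ))
    (hCassels : bsdRHS_eq_of_isIsogenous) (hGZK : rank_eq_analyticRank_of_analyticRank_le_one)
    (hmod : hasEntireLFunction_rat) (W₀ : WeierstrassCurve ℚ) (hW₀ : W₀ = ⟨1, 1, 0, -10609224785, 425913082259605⟩)
    (hr : W₀.analyticRank = 0) {s : ℚ} (hs : shaAn W₀ = (s : ℂ)) (hv : padicValRat 5 s ≤ 2)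
    (hSel : W₀.selmerGroup (5 : ℤ) ≠ ⊥) (W : WeierstrassCurve ℚ) [W.IsElliptic] [W.IsGloballyMinimal]
    (hiso : IsIsogenous W W₀) : MissingLowerBoundAt W 5 := by
  subst hW₀
  haveI : Fact (Nat.Prime 5) := ⟨by norm_num⟩
  exact KTPdesc.missingLowerBoundAt_of_isIsogenous_ainvs_of_selmerGroup_ne_bot hCT hCassels hGZK hmod
    1 1 0 (-10609224785) 425913082259605
    (X11b.isGloballyMinimal_of_krausCriterion_support 1 1 0 (-10609224785) 425913082259605
      [(2, 1, 25), (5, 2, 2), (13, 2, 16), (59, 1, 2)]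
      (by intro t ht; simp only [List.mem_cons, List.not_mem_nil, or_false] at ht; rcases ht with rfl | rfl | rfl | rfl <;> norm_num)
      (by decide +kernel) (by decide +kernel))
    5 7 (by norm_num) (by norm_num) (by decide +kernel) (n := 6) (by decide +kernel) (by decide)
    hr hs hv hSel W hiso

end Summit.BirchSwinnertonDyer.BirchSwinnertonDyer.Theorems

end
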